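import Mathlib.Geometry.Euclidean.Angle.Unoriented.TriangleInequality
import Summits.AtomisticToContinuum.Crystallization.Theorems.TwoCentreKissingKernelRobustTangencyBoundVertexStar
import HarnessLib

/-!
# `RobustTangencyBound` — fan decomposition of the corners of a polygonal facet (step (III),
# generic lemmas G1/G3 of blueprint (III) §7)

Route `TwoCentreKissingKernel`, item `stmt-AtomisticToContinuum-12082`.  A polygonal facet of the hull (`m ≥ 4` cocircular
vertices) enters the "diagonal form" of the cluster lemmas through its FAN: the corner at a
vertex `y` between its facet-neighbours is the sum of the angles between consecutive directions
towards the other vertices — no new trigonometry, only betweenness in the tangent plane at `y`: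

* `tangentProj_add/_smul/_self_unit` — `t_y` is linear and kills `y`;
* `tangentProj_mem_span_of_orient3_pos` (G1) — if `det[y;a;b], det[y;b;c], det[y;a;c] > 0` then
  `t_y b` is a nonnegative combination of `t_y a` and `t_y c` (Cramer, `orient3_expand`);
* `angle_tangent_split` — hence `∠(t_y a, t_y c) = ∠(t_y a, t_y b) + ∠(t_y b, t_y c)`
  (Mathlib's `angle_eq_angle_add_add_angle_add_of_mem_span`), and in product form
  `e^{i∠(a,c)} = e^{i∠(a,b)} e^{i∠(b,c)}` (`cexp_angle_tangent_split`);
* `orient3_facetVertex_pos_of_cyclic` — the sign hypotheses hold for the vertices of a facet taken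
  in cyclic order (from `orient3_facetVertex_pos`).
-/

noncomputable section

namespace Summit.AtomisticToContinuum.Crystallization.Theorems

open Real RealInnerProductSpace InnerProductGeometry Literature.Geometry.DiscreteGeometry NNReal

/-! ### The tangent projection is linear -/

/-- `t_v (u + u') = t_v u + t_v u'`. -/
theorem tangentProj_add (v u u' : EuclideanSpace ℝ (Fin 3)) :
    tangentProj v (u + u') = tangentProj v u + tangentProj v u' := by
  simp only [tangentProj, inner_add_right, add_smul]
  abel

/-- `t_v (c • u) = c • t_v u`. -/
theorem tangentProj_smul (v : EuclideanSpace ℝ (Fin 3)) (c : ℝ) (u : EuclideanSpace ℝ (Fin 3)) :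
    tangentProj v (c • u) = c • tangentProj v u := by
  simp only [tangentProj, real_inner_smul_right, smul_sub, smul_smul, mul_comm c]

/-- `t_v v = 0` for a unit vector `v`. -/
theorem tangentProj_self_unit {v : EuclideanSpace ℝ (Fin 3)} (hv : ‖v‖ = 1) : tangentProj v v = 0 := by
  simp only [tangentProj, real_inner_self_eq_norm_sq, hv, one_pow, one_smul, sub_self]

/-! ### G1: betweenness in the tangent plane from orientation signs -/

/-- **Betweenness from orientations (G1).** For a unit vector `y` and vectors `a, b, c` with
`det[y;a;b] > 0`, `det[y;b;c] > 0` and `det[y;a;c] > 0` (counter-clockwise order `a, b, c` seen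
from `y`, within a half-turn), the tangent component `t_y b` is a nonnegative combination of
`t_y a` and `t_y c`: `det[y;a;c] • t_y b = det[y;b;c] • t_y a + det[y;a;b] • t_y c`. -/
theorem tangentProj_mem_span_of_orient3_pos {y a b c : EuclideanSpace ℝ (Fin 3)} (hy : ‖y‖ = 1)
    (hab : 0 < orient3 y a b) (hbc : 0 < orient3 y b c) (hac : 0 < orient3 y a c) :
    tangentProj y b ∈ Submodule.span ℝ≥0 ({tangentProj y a, tangentProj y c} : Set _) := by
  -- Cramer: `det[y;a;c] • b = det[b;a;c] • y + det[y;b;c] • a + det[y;a;b] • c`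
  have hexp := orient3_expand y a c b
  have hT := congrArg (tangentProj y) hexp
  rw [tangentProj_smul, tangentProj_add, tangentProj_add, tangentProj_smul, tangentProj_smul,
    tangentProj_smul, tangentProj_self_unit hy, smul_zero, zero_add] at hT
  -- divide by `det[y;a;c] > 0`
  have hD : orient3 y a c ≠ 0 := hac.ne'
  have hb : tangentProj y b = (orient3 y b c / orient3 y a c) • tangentProj y a +
      (orient3 y a b / orient3 y a c) • tangentProj y c := by
    have := congrArg (fun z => (orient3 y a c)⁻¹ • z) hT
    simp only [smul_smul, inv_mul_cancel₀ hD, one_smul, smul_add] at this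
    rw [this, div_eq_inv_mul, div_eq_inv_mul]
  rw [Submodule.mem_span_pair]
  refine ⟨⟨orient3 y b c / orient3 y a c, div_nonneg hbc.le hac.le⟩,
    ⟨orient3 y a b / orient3 y a c, div_nonneg hab.le hac.le⟩, ?_⟩
  rw [NNReal.smul_def, NNReal.smul_def]
  change (orient3 y b c / orient3 y a c) • tangentProj y a +
      (orient3 y a b / orient3 y a c) • tangentProj y c = tangentProj y b
  exact hb.symm

/-- **Corner additivity along a fan direction.** Under the sign hypotheses of G1 (and `t_y b ≠ 0`),
`∠(t_y a, t_y c) = ∠(t_y a, t_y b) + ∠(t_y b, t_y c)`. -/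
theorem angle_tangent_split {y a b c : EuclideanSpace ℝ (Fin 3)} (hy : ‖y‖ = 1)
    (hab : 0 < orient3 y a b) (hbc : 0 < orient3 y b c) (hac : 0 < orient3 y a c)
    (hb : tangentProj y b ≠ 0) :
    angle (tangentProj y a) (tangentProj y c) =
      angle (tangentProj y a) (tangentProj y b) + angle (tangentProj y b) (tangentProj y c) :=
  angle_eq_angle_add_add_angle_add_of_mem_span hb (tangentProj_mem_span_of_orient3_pos hy hab hbc hac)

/-- The same in product form: `e^{i∠(t_y a, t_y c)} = e^{i∠(t_y a, t_y b)} · e^{i∠(t_y b, t_y c)}`. -/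
theorem cexp_angle_tangent_split {y a b c : EuclideanSpace ℝ (Fin 3)} (hy : ‖y‖ = 1)
    (hab : 0 < orient3 y a b) (hbc : 0 < orient3 y b c) (hac : 0 < orient3 y a c)
    (hb : tangentProj y b ≠ 0) :
    Complex.exp ((angle (tangentProj y a) (tangentProj y c) : ℝ) * Complex.I) =
      Complex.exp ((angle (tangentProj y a) (tangentProj y b) : ℝ) * Complex.I) *
        Complex.exp ((angle (tangentProj y b) (tangentProj y c) : ℝ) * Complex.I) := by
  rw [← Complex.exp_add, angle_tangent_split hy hab hbc hac hb]
  push_cast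
  ring_nf

/-- A vertex other than `y` of a spherical code has a nonzero tangent component at `y`
(`⟪y, b⟫² < 1`). -/
theorem tangentProj_ne_zero_of_inner_sq_lt {y b : EuclideanSpace ℝ (Fin 3)} (hy : ‖y‖ = 1)
    (hb : ‖b‖ = 1) (h : ⟪y, b⟫ ^ 2 < 1) : tangentProj y b ≠ 0 := by
  intro h0
  have := norm_sq_tangentProj hy hb
  rw [h0, norm_zero] at this
  nlinarith

/-! ### The sign hypotheses for the vertices of a facet in cyclic order -/

/-- **Facet vertices in cyclic order are positively oriented.** For a facet `c` of the hull of a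
spherical code and indices `i, j, k` in cyclic order (`i < j < k`, or `j < k < i`, or `k < i < j`),
`det[v_i; v_j; v_k] > 0`. -/
theorem orient3_facetVertex_pos_of_cyclic {X : Finset (EuclideanSpace ℝ (Fin 3))}
    (hX1 : ∀ z ∈ X, ‖z‖ = 1) {c : EuclideanSpace ℝ (Fin 3)} (hcF : c ∈ facetNormals X) {i j k : ℕ}
    (hi : i < (facetAngles X c (ne_zero_of_mem_facetNormals hX1 hcF)).card)
    (hj : j < (facetAngles X c (ne_zero_of_mem_facetNormals hX1 hcF)).card)
    (hk : k < (facetAngles X c (ne_zero_of_mem_facetNormals hX1 hcF)).card)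
    (hcyc : (i < j ∧ j < k) ∨ (j < k ∧ k < i) ∨ (k < i ∧ i < j)) :
    0 < orient3 (facetVertex X c (ne_zero_of_mem_facetNormals hX1 hcF) i)
      (facetVertex X c (ne_zero_of_mem_facetNormals hX1 hcF) j)
      (facetVertex X c (ne_zero_of_mem_facetNormals hX1 hcF) k) := by
  rcases hcyc with ⟨hij, hjk⟩ | ⟨hjk, hki⟩ | ⟨hki, hij⟩
  · exact orient3_facetVertex_pos hX1 hcF hij hjk hk
  · rw [orient3_cyclic]
    exact orient3_facetVertex_pos hX1 hcF hjk hki hi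
  · rw [orient3_cyclic, orient3_cyclic]
    exact orient3_facetVertex_pos hX1 hcF hki hij hj

/-- **Fan step for a facet corner (G3, one step).** For a facet `c` and indices `j, a, b, d` in
cyclic order (`j` the corner vertex, `a` and `d` its relevant fan directions with `b` in between),
the tangent component at `v_j` of `v_b` lies between those of `v_a` and `v_d`, so
`∠(t v_a, t v_d) = ∠(t v_a, t v_b) + ∠(t v_b, t v_d)` at `v_j`. -/
theorem facet_corner_fan_step {X : Finset (EuclideanSpace ℝ (Fin 3))}
    (hX1 : ∀ z ∈ X, ‖z‖ = 1) {c : EuclideanSpace ℝ (Fin 3)} (hcF : c ∈ facetNormals X) {j a b d : ℕ}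
    (hj : j < (facetAngles X c (ne_zero_of_mem_facetNormals hX1 hcF)).card)
    (ha : a < (facetAngles X c (ne_zero_of_mem_facetNormals hX1 hcF)).card)
    (hb : b < (facetAngles X c (ne_zero_of_mem_facetNormals hX1 hcF)).card)
    (hd : d < (facetAngles X c (ne_zero_of_mem_facetNormals hX1 hcF)).card)
    (hjab : (j < a ∧ a < b) ∨ (a < b ∧ b < j) ∨ (b < j ∧ j < a))
    (hjbd : (j < b ∧ b < d) ∨ (b < d ∧ d < j) ∨ (d < j ∧ j < b))
    (hjad : (j < a ∧ a < d) ∨ (a < d ∧ d < j) ∨ (d < j ∧ j < a))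
    (hsep : ⟪facetVertex X c (ne_zero_of_mem_facetNormals hX1 hcF) j,
      facetVertex X c (ne_zero_of_mem_facetNormals hX1 hcF) b⟫ ^ 2 < 1) :
    angle (tangentProj (facetVertex X c (ne_zero_of_mem_facetNormals hX1 hcF) j)
        (facetVertex X c (ne_zero_of_mem_facetNormals hX1 hcF) a))
      (tangentProj (facetVertex X c (ne_zero_of_mem_facetNormals hX1 hcF) j)
        (facetVertex X c (ne_zero_of_mem_facetNormals hX1 hcF) d)) =
    angle (tangentProj (facetVertex X c (ne_zero_of_mem_facetNormals hX1 hcF) j)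
        (facetVertex X c (ne_zero_of_mem_facetNormals hX1 hcF) a))
      (tangentProj (facetVertex X c (ne_zero_of_mem_facetNormals hX1 hcF) j)
        (facetVertex X c (ne_zero_of_mem_facetNormals hX1 hcF) b)) +
    angle (tangentProj (facetVertex X c (ne_zero_of_mem_facetNormals hX1 hcF) j)
        (facetVertex X c (ne_zero_of_mem_facetNormals hX1 hcF) b))
      (tangentProj (facetVertex X c (ne_zero_of_mem_facetNormals hX1 hcF) j)
        (facetVertex X c (ne_zero_of_mem_facetNormals hX1 hcF) d)) := by
  have hc := ne_zero_of_mem_facetNormals hX1 hcF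
  have hyX : facetVertex X c hc j ∈ X := (mem_tightSet.1 (facetVertex_mem hc hj)).1
  have hbX : facetVertex X c hc b ∈ X := (mem_tightSet.1 (facetVertex_mem hc hb)).1
  exact angle_tangent_split (hX1 _ hyX)
    (orient3_facetVertex_pos_of_cyclic hX1 hcF hj ha hb hjab)
    (orient3_facetVertex_pos_of_cyclic hX1 hcF hj hb hd hjbd)
    (orient3_facetVertex_pos_of_cyclic hX1 hcF hj ha hd hjad)
    (tangentProj_ne_zero_of_inner_sq_lt (hX1 _ hyX) (hX1 _ hbX) hsep)

end Summit.AtomisticToContinuum.Crystallization.Theorems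

end
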